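import Summits.BirchSwinnertonDyer.BirchSwinnertonDyer.Theorems.ManinLocalTwoThreeIstarTwoNormalForm
import HarnessLib

/-!
# S-an-63 «16 ∥ N descends», row `I₂*/10`: a curve of Kodaira type `I₂*` at `2` with `ord₂ Δ_min = 10` (`f₂ = 4`) has `χ₋₄`-twist of
# type `III*` (`f₂ = 3`) — Barrios et al. 2025 Thm. 5.1, row I₂*, `d ≡ 3 (4)`, for `d = −1`
# (route `ManinLocalTwoThree`, crux C2 `ManinOddAtFour` stmt-BirchSwinnertonDyer-22967; cell bsd-f2-manin, an's candidate S-an-63; p3 gen 12)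

Third row of the `f₂ = 4` list.  The `I₂*` normal form with exit witness (sibling `…IstarTwoNormalForm`) is `N = [2α, 2p, 8γ, 8q, 32r]` with
`p, q ∈ ℤ₂ˣ`, and `ord₂ Δ = 10` adds `α ∈ ℤ₂ˣ`.  §1: the twist read over `ℚ₂` is `T = [0, −(α²+2p), 0, 8(q+αγ), −16(γ²+2r)]`.  §2: on
`T″ = (1, 0, 1, 4γ) • T = [2, −(α²+1+2p), 8γ, 8(q+αγ−γ), −32(γ²+r)]` one has `4 ∣ a₂″` (`α² + 1 + 2p = 4(1+κ+κ²+ρ)` for `α = 1+2κ`,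
`p = 1+2ρ`), `8 ∣ a₃″, a₄″`, `32 ∣ a₆″` and `a₄″/8 = q + 2κγ ∈ ℤ₂ˣ`: Step 9 returns **`III*`** (`kodairaSymbolOfMinimal_eq_IIIstar_of_step9`).
§3: Ogg on the exit model with `ord₂ Δ = 10` unchanged: `f₂(W ⊗ (−1)) = 10 + 1 − 8 = 3`.
HONEST FRAMING: a local theorem in print, kernel-checked; nothing about BSD or Manin's conjecture is proved; C2 OPEN.
[cite: BarriosEtAl2025, Thm. 5.1 (arXiv:2501.03209 p. 16), row I₂*, (f, f^d) = (4,3)] [cite: SilvermanATAEC1994, IV.9.4 Steps 7–9 and IV.11.1]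
-/

set_option autoImplicit false
-- lint-debt: the directory name repeats the summit name (sibling precedent `ManinLocalTwoThreeNegOneTwistConductorAtTwo.lean`)
set_option linter.dupNamespace false

noncomputable section

open scoped Classical
open Polynomial IsLocalRing WeierstrassCurve
open IsDiscreteValuationRing hiding maximalIdeal
open Literature.NumberTheory.DiophantineGeometry Literature.NumberTheory.DiophantineGeometry.TateAlgorithm
  Literature.NumberTheory.DiophantineGeometry.TateAlgorithm.CharTwo

namespace Summit.BirchSwinnertonDyer.BirchSwinnertonDyer.Theorems.ManinLocalTwoThree

/-! ## §1 The `χ₋₄`-twist of the `I₂*` normal form -/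

/-- Twist of the `I₂*` form `[2α, 2p, 8γ, 8q, 32r]`: `[0, −(α² + 2p), 0, 8(q + αγ), −16(γ² + 2r)]`, read over `ℚ₂`.
[cite: SilvermanAEC2009, X.2 Prop. 2.4 (shape of the quadratic twist)] -/
theorem quadraticTwist_negOne_map_of_IstarTwoForm (N : WeierstrassCurve ℤ_[2]) {α p γ q r : ℤ_[2]}
    (h₁ : N.a₁ = 2 * α) (h₂ : N.a₂ = 2 * p) (h₃ : N.a₃ = 2 ^ 3 * γ) (h₄ : N.a₄ = 2 ^ 3 * q) (h₆ : N.a₆ = 2 ^ 5 * r) :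
    (N.map (algebraMap ℤ_[2] ℚ_[2])).quadraticTwist (-1) =
      (⟨0, -(α ^ 2 + 2 * p), 0, 8 * (q + α * γ), -(16 * (γ ^ 2 + 2 * r))⟩ : WeierstrassCurve ℤ_[2]).map
        (algebraMap ℤ_[2] ℚ_[2]) := by
  obtain ⟨a₁, a₂, a₃, a₄, a₆⟩ := N
  simp only at h₁ h₂ h₃ h₄ h₆
  subst h₁ h₂ h₃ h₄ h₆
  have c2 : ((2 : ℤ_[2]) : ℚ_[2]) = 2 := map_ofNat PadicInt.Coe.ringHom 2
  have c8 : ((8 : ℤ_[2]) : ℚ_[2]) = 8 := map_ofNat PadicInt.Coe.ringHom 8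
  have c16 : ((16 : ℤ_[2]) : ℚ_[2]) = 16 := map_ofNat PadicInt.Coe.ringHom 16
  ext <;> simp [WeierstrassCurve.quadraticTwist, WeierstrassCurve.map, WeierstrassCurve.b₂, WeierstrassCurve.b₄,
    WeierstrassCurve.b₆, c2, c8, c16] <;> ring

/-! ## §2 Tate's algorithm on the twisted model: type `III*` -/

/-- **The twist of the `I₂*/10`-form is of type `III*`** (`α = 1 + 2κ`, `p = 1 + 2ρ`, `q ∈ ℤ₂ˣ`): Step 9 on
`T″ = (1, 0, 1, 4γ) • [0, −(α²+2p), 0, 8(q+αγ), −16(γ²+2r)]`. [cite: SilvermanATAEC1994, IV.9.4 Steps 1–9] -/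
theorem kodairaSymbolOfMinimal_negTwist_IstarTwo_IIIstar {α p γ q r κ ρ : ℤ_[2]} (hα : α = 1 + 2 * κ) (hp : p = 1 + 2 * ρ)
    (hq : IsUnit q) :
    ((⟨1, 0, 1, 4 * γ⟩ : VariableChange ℤ_[2]) •
        (⟨0, -(α ^ 2 + 2 * p), 0, 8 * (q + α * γ), -(16 * (γ ^ 2 + 2 * r))⟩ : WeierstrassCurve ℤ_[2])).kodairaSymbolOfMinimal =
      .IIIstar := by
  have hirr : Irreducible (2 : ℤ_[2]) := by exact_mod_cast PadicInt.irreducible_p (p := 2)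
  set T' : WeierstrassCurve ℤ_[2] := (⟨1, 0, 1, 4 * γ⟩ : VariableChange ℤ_[2]) •
    (⟨0, -(α ^ 2 + 2 * p), 0, 8 * (q + α * γ), -(16 * (γ ^ 2 + 2 * r))⟩ : WeierstrassCurve ℤ_[2]) with hT'
  have e1 : T'.a₁ = 2 * 1 := by rw [hT', variableChange_a₁]; simp
  have e2 : T'.a₂ = 2 ^ 2 * (-(1 + κ + κ ^ 2 + ρ)) := by
    rw [hT', variableChange_a₂]; simp; rw [hα, hp]; ring
  have e3 : T'.a₃ = 2 ^ 3 * γ := by rw [hT', variableChange_a₃]; simp; ring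
  have e4 : T'.a₄ = 2 ^ 3 * (q + 2 * κ * γ) := by
    rw [hT', variableChange_a₄]; simp; rw [hα]; ring
  have e6 : T'.a₆ = 2 ^ 5 * (-(γ ^ 2 + r)) := by rw [hT', variableChange_a₆]; simp; ring
  refine kodairaSymbolOfMinimal_eq_IIIstar_of_step9 ?_ ?_ ?_ ?_ ?_ ?_ <;>
    try simp only [uniformizer_dvd_iff_two_dvd, uniformizer_pow_dvd_iff_two_pow_dvd]
  · rw [e1]; exact dvd_mul_right _ _
  · rw [e2]; exact dvd_mul_right _ _
  · rw [e3]; exact dvd_mul_right _ _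
  · rw [e4]; exact dvd_mul_right _ _
  · rw [e6]; exact dvd_mul_right _ _
  · rw [e4, show (2 : ℤ_[2]) ^ 4 = 2 ^ 3 * 2 by norm_num]
    intro h
    have h' : (2 : ℤ_[2]) ∣ q + 2 * κ * γ := (mul_dvd_mul_iff_left (by norm_num)).mp h
    have hu : IsUnit (q + 2 * κ * γ) := by
      rw [show q + 2 * κ * γ = q + 2 * (κ * γ) by ring]; exact isUnit_add_mul_of_isUnit hirr hq _
    exact (isUnit_iff_not_dvd hirr _).mp hu h'

/-! ## §3 The global assembly: `I₂*` with `ord₂ Δ_min = 10` twists to `f₂ = 3` -/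

/-- **S-an-63, row `I₂*/10`** (Barrios et al. 2025 Thm. 5.1, row I₂*, `d ≡ 3 (4)`, kernel-checked for `d = −1`): if `W/ℚ` is of Kodaira
type `I₂*` at `2` with `ord₂ Δ_min = 10` (the `f₂ = 4` stratum of type `I₂*`), then `f₂(W ⊗ (−1)) = 3` (type `III*`).
[cite: BarriosEtAl2025, Thm. 5.1 (arXiv:2501.03209 p. 16), row I₂*, (f, f^d) = (4,3)] [cite: SilvermanATAEC1994, IV.9.4 and IV.11.1] -/
theorem conductorExponent_quadraticTwist_negOne_of_IstarTwo_ten (W : WeierstrassCurve ℚ) [W.IsElliptic]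
    (hK : W.kodairaSymbolAt ((Rat.HeightOneSpectrum.primesEquiv (R := ℤ)).symm ⟨2, Nat.prime_two⟩) = .Istar 2)
    (hord : W.ordMinimalDiscriminant ((Rat.HeightOneSpectrum.primesEquiv (R := ℤ)).symm ⟨2, Nat.prime_two⟩) = 10) :
    (W.quadraticTwist ((-1 : ℤ) : ℚ)).conductorExponent ((Rat.HeightOneSpectrum.primesEquiv (R := ℤ)).symm ⟨2, Nat.prime_two⟩) = 3 := by
  haveI : Fact (Nat.Prime 2) := ⟨Nat.prime_two⟩
  haveI : Finite (ResidueField ℤ_[2]) := Finite.of_equiv _ (PadicInt.residueField (p := 2)).toEquiv.symm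
  have hirr : Irreducible (2 : ℤ_[2]) := by exact_mod_cast PadicInt.irreducible_p (p := 2)
  have h2m : (2 : ℤ_[2]) ∈ maximalIdeal ℤ_[2] := (IsLocalRing.mem_maximalIdeal _).mpr hirr.not_isUnit
  set v : IsDedekindDomain.HeightOneSpectrum ℤ := (Rat.HeightOneSpectrum.primesEquiv (R := ℤ)).symm ⟨2, Nat.prime_two⟩
    with hvdef
  have e : Rat.HeightOneSpectrum.primesEquiv (R := ℤ) v = ⟨2, Nat.prime_two⟩ := Equiv.apply_symm_apply _ _
  -- Kodaira `I₂*` and `ord Δ_min = 10`, read over `ℤ₂`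
  have hKp := WeierstrassCurve.kodairaSymbolAt_eq_padic (R := ℤ) v W
  rw [e] at hKp
  change W.kodairaSymbolAt v = (((W.baseChange ℚ_[2]).minimal ℤ_[2]).integralModel ℤ_[2]).kodairaSymbolOfMinimal at hKp
  have hOp := WeierstrassCurve.ordMinimalDiscriminant_eq_padic (R := ℤ) v W
  rw [e] at hOp
  change W.ordMinimalDiscriminant v =
    (IsDiscreteValuationRing.addVal ℤ_[2] (((W.baseChange ℚ_[2]).minimal ℤ_[2]).integralModel ℤ_[2]).Δ).toNat at hOp
  set X : WeierstrassCurve ℚ_[2] := W.baseChange ℚ_[2] with hX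
  set V₀ : WeierstrassCurve ℤ_[2] := (X.minimal ℤ_[2]).integralModel ℤ_[2] with hV₀
  set E : VariableChange ℚ_[2] := (X.exists_isMinimal ℤ_[2]).choose with hE
  have hmin : X.minimal ℤ_[2] = E • X := rfl
  have hV₀X : V₀.baseChange ℚ_[2] = X.minimal ℤ_[2] := WeierstrassCurve.baseChange_integralModel_eq ℤ_[2] _
  rw [hK] at hKp
  rw [hord] at hOp
  have hΔ0 : V₀.Δ ≠ 0 := by
    intro h0; rw [h0] at hOp; simp at hOp
  -- the twist over `ℚ₂`
  have hd0 : ((-1 : ℤ) : ℚ) ≠ 0 := by norm_num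
  haveI := W.isElliptic_quadraticTwist hd0
  set Xm : WeierstrassCurve ℚ_[2] := (W.quadraticTwist ((-1 : ℤ) : ℚ)).baseChange ℚ_[2] with hXm
  have hXmX : Xm = X.quadraticTwist (-1) := by
    rw [hXm, hX, WeierstrassCurve.baseChange, WeierstrassCurve.baseChange, WeierstrassCurve.map_quadraticTwist]
    simp
  have hΔtw : ∀ (D : VariableChange ℤ_[2]) (T : WeierstrassCurve ℤ_[2]),
      ((D • V₀).map (algebraMap ℤ_[2] ℚ_[2])).quadraticTwist (-1) = T.map (algebraMap ℤ_[2] ℚ_[2]) → T.Δ = (D • V₀).Δ := by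
    intro D T hNT
    have hΔT : (T.Δ : ℚ_[2]) = ((D • V₀).Δ : ℚ_[2]) := by
      have h1 : (T.map (algebraMap ℤ_[2] ℚ_[2])).Δ = (((D • V₀).map (algebraMap ℤ_[2] ℚ_[2])).quadraticTwist (-1)).Δ := by
        rw [hNT]
      rw [WeierstrassCurve.map_Δ, WeierstrassCurve.quadraticTwist_Δ, WeierstrassCurve.map_Δ] at h1
      norm_num at h1
      exact h1
    exact IsFractionRing.injective ℤ_[2] ℚ_[2] hΔT
  have key : ∀ (D : VariableChange ℤ_[2]) (T : WeierstrassCurve ℤ_[2]) (C₆ : VariableChange ℤ_[2]),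
      ((D • V₀).map (algebraMap ℤ_[2] ℚ_[2])).quadraticTwist (-1) = T.map (algebraMap ℤ_[2] ℚ_[2]) →
      (C₆ • T).kodairaSymbolOfMinimal ≠ .I 0 →
      (W.quadraticTwist ((-1 : ℤ) : ℚ)).conductorExponent v =
        (IsDiscreteValuationRing.addVal ℤ_[2] V₀.Δ).toNat + 1 - (C₆ • T).kodairaSymbolOfMinimal.numComponents := by
    intro D T C₆ hNT hne
    set Ctot : VariableChange ℚ_[2] := D.map (algebraMap ℤ_[2] ℚ_[2]) * E with hCtot
    have hCX : Ctot • X = (D • V₀).map (algebraMap ℤ_[2] ℚ_[2]) := by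
      rw [hCtot, mul_smul, ← hmin, ← hV₀X]
      exact WeierstrassCurve.map_variableChange _ _ _
    set C₁ : VariableChange ℚ_[2] := ⟨Ctot.u, (-1) * Ctot.r, 0, 0⟩ with hC₁
    have hT : T.map (algebraMap ℤ_[2] ℚ_[2]) = C₁ • Xm := by
      rw [← hNT, ← hCX, WeierstrassCurve.quadraticTwist_smul, hXmX]
    have hT' : (C₆ • T).map (algebraMap ℤ_[2] ℚ_[2]) = (C₆.map (algebraMap ℤ_[2] ℚ_[2]) * C₁) • Xm := by
      rw [mul_smul, ← hT]
      exact (WeierstrassCurve.map_variableChange _ _ _).symm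
    rw [conductorExponent_negTwist_of_exitModel W (C₆ • T) _ hT' hne, addVal_Δ_smul_toNat, hΔtw D T hNT, addVal_Δ_smul_toNat]
  -- the `I₂*/10` normal form with unit witnesses
  obtain ⟨D, hu, h₁, h₂, h₂n, h₃, h₄, h₄n, h₆⟩ := exists_smul_of_kodairaSymbolOfMinimal_eq_Istar_two_of_two_mem h2m V₀ hKp.symm
  have hm : ∀ {x : ℤ_[2]}, x ∈ maximalIdeal ℤ_[2] ↔ (2 : ℤ_[2]) ∣ x := fun {x} ↦ mem_maximalIdeal_iff_dvd_of_irreducible hirr x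
  have hmn : ∀ {x : ℤ_[2]} {n : ℕ}, x ∈ maximalIdeal ℤ_[2] ^ n ↔ (2 : ℤ_[2]) ^ n ∣ x := fun {x n} ↦
    mem_maximalIdeal_pow_iff_dvd_of_irreducible hirr x n
  obtain ⟨α, hα⟩ := hm.mp h₁
  obtain ⟨p, hp⟩ := hm.mp h₂
  obtain ⟨γ, hγ⟩ := hmn.mp h₃
  obtain ⟨q, hq⟩ := hmn.mp h₄
  obtain ⟨r, hr⟩ := hmn.mp h₆
  have hpu : IsUnit p := by
    rw [isUnit_iff_not_dvd hirr]
    rintro ⟨p', hp'⟩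
    exact h₂n (hmn.mpr ⟨p', by rw [hp, hp']; ring⟩)
  have hqu : IsUnit q := by
    rw [isUnit_iff_not_dvd hirr]
    rintro ⟨q', hq'⟩
    exact h₄n (hmn.mpr ⟨q', by rw [hq, hq']; ring⟩)
  have hΔN0 : (D • V₀).Δ ≠ 0 := by rw [Δ_smul_of_u_eq_one hu]; exact hΔ0
  have hΔN : (IsDiscreteValuationRing.addVal ℤ_[2] (D • V₀).Δ).toNat = 10 := by rw [addVal_Δ_smul_toNat, ← hOp]
  have hαu : IsUnit α := isUnit_of_istarTwoForm_of_addVal_eq_ten hirr (D • V₀) hα hp hγ hq hr hΔN0 hΔN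
  obtain ⟨κ, hκ⟩ := exists_eq_one_add_two_mul_of_isUnit_padicInt hαu
  obtain ⟨ρ, hρ⟩ := exists_eq_one_add_two_mul_of_isUnit_padicInt hpu
  have hNT := quadraticTwist_negOne_map_of_IstarTwoForm (D • V₀) hα hp hγ hq hr
  have hexit := kodairaSymbolOfMinimal_negTwist_IstarTwo_IIIstar (γ := γ) (r := r) hκ hρ hqu
  rw [key D _ ⟨1, 0, 1, 4 * γ⟩ hNT (by rw [hexit]; decide), hexit, ← hOp]
  rfl

/-- **S-an-63, row `I₂*/10`, in the `≤ 3` form.** [cite: BarriosEtAl2025, Thm. 5.1 (arXiv:2501.03209 p. 16), row I₂*] -/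
theorem conductorExponent_quadraticTwist_negOne_le_three_of_IstarTwo_ten (W : WeierstrassCurve ℚ) [W.IsElliptic]
    (hK : W.kodairaSymbolAt ((Rat.HeightOneSpectrum.primesEquiv (R := ℤ)).symm ⟨2, Nat.prime_two⟩) = .Istar 2)
    (hord : W.ordMinimalDiscriminant ((Rat.HeightOneSpectrum.primesEquiv (R := ℤ)).symm ⟨2, Nat.prime_two⟩) = 10) :
    (W.quadraticTwist ((-1 : ℤ) : ℚ)).conductorExponent ((Rat.HeightOneSpectrum.primesEquiv (R := ℤ)).symm ⟨2, Nat.prime_two⟩) ≤ 3 :=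
  (conductorExponent_quadraticTwist_negOne_of_IstarTwo_ten W hK hord).le

end Summit.BirchSwinnertonDyer.BirchSwinnertonDyer.Theorems.ManinLocalTwoThree

end
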